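import Summits.Ventures.Crystal3D.Theorems.StickyWulffConstantCoaxialWallLawOnSiteBridgeCx
import HarnessLib

/-!
# The lane-F closing theorem with the OFF-MODULE TAILS AT `s_F = 2√6` (monotonicity in the constant)
# (crux `CoaxialWallLaw`, stmt-Ventures-19481, line `WallLedgerF`)

HONEST FRAMING. Venture `Summits/Ventures/Crystal3D` (cell `crystal3d-full`), helper `--supports` the crux
`CoaxialWallLaw` (stmt-Ventures-19481, `route-Ventures-StickyWulffConstant`), REGISTERED line `WallLedgerF` (planner
cf-p1).  Rung credit; F-C1 NOT moved.  cf-p1 DECISION (lxxiv)(2) (2026-08-29T00:54:38Z): «s_F OF THE TAIL := 2√6 — the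
weakest line that still yields `c₁ = ½` exactly (the row cone's coefficient is `√6/s_F`, `= ½` at `2√6`); the certified
on-site flat at `9/2` (max `1783/420`) implies the flat at `2√6` by monotonicity; 19481-p2 lands the one-line mono
lemmas and RESTATES the two tail debts at `2√6`».  This file does exactly that:

* `endRowOnSiteFlatA_mono_const`, `endRowOnSiteA_mono_const`, `endRowTransTailA_mono_const`,
  `endRowTwinTailA_mono_const`, `localEndRowA_mono_const`, `endRowTransA_mono_const`,
  `endRowTwinHalfTurnA_mono_const` — every on-site fact, tail and row is MONOTONE in the constant `s_F`
  (`s ≤ s' ⇒ fact at s ⇒ fact at s'`);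
* **`coaxialWallLaw_of_onSiteFlatA_v2A_twoSqrtSix_cx : P5Exhaustion →
  EndRowOnSiteFlatA v2 (9/2) coaxialModuleUniverse → EndRowTwinTailA v2 (2√6) coaxialModuleUniverse →
  EndRowTransTailA v2 (2√6) coaxialModuleUniverse → CoaxialWallLaw`** — THE LANE-F CLOSING THEOREM OF RECORD after
  (lxxiv): certificate at `9/2` (fed through `endRowOnSiteFlatA_mono_const`), tails at `2√6`
  (`coaxialWallLaw_of_onSiteFlatA_cx_certified` at `s_F = 2√6`);
* `coaxialWallLaw_of_onSiteFlatA_twoSqrtSix_cx` — the same with the certificate at any `s ≤ 2√6`.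
REMAINING BY-NAME DEBTS of lane F after this file: `P5Exhaustion` · `EndRowOnSiteFlatA v2 (9/2) coaxialModuleUniverse`
[computational, bnb-ucx] · the two OFF-MODULE tails **at `2√6`**: `EndRowTwinTailA v2 (2√6) coaxialModuleUniverse`,
`EndRowTransTailA v2 (2√6) coaxialModuleUniverse`.
WHAT THIS IS NOT: not the certificate, not the tails; F-C1 not moved.
-/

noncomputable section

namespace Summit.Ventures.Crystal3D.Theorems

open Summit.Ventures.Crystal3D Finset
open scoped InnerProductSpace

/-! ### Monotonicity in the constant -/

section Mono

variable {v : WordVersion} {s s' : ℝ} {𝒰 : Set (Finset (EuclideanSpace ℝ (Fin 3)))}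

/-- The flat on-site fact is monotone in the constant. -/
theorem endRowOnSiteFlatA_mono_const (hs : s ≤ s') (h : EndRowOnSiteFlatA v s 𝒰) : EndRowOnSiteFlatA v s' 𝒰 :=
  fun P hP => ⟨fun ε n hn => ((h P hP).1 ε n hn).trans hs, fun ε k hk => ((h P hP).2 ε k hk).trans hs⟩

/-- The on-site fact is monotone in the constant. -/
theorem endRowOnSiteA_mono_const (hs : s ≤ s') (h : EndRowOnSiteA v s 𝒰) : EndRowOnSiteA v s' 𝒰 :=
  fun P hP => ⟨fun ε n hn => ((h P hP).1 ε n hn).trans hs, fun ε k hk => ((h P hP).2 ε k hk).trans hs⟩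

/-- The translation tail is monotone in the constant. -/
theorem endRowTransTailA_mono_const (hs : s ≤ s') (h : EndRowTransTailA v s 𝒰) : EndRowTransTailA v s' 𝒰 :=
  fun L X hX z hz hdeg hoff => (h L X hX z hz hdeg hoff).trans hs

/-- The twin tail is monotone in the constant. -/
theorem endRowTwinTailA_mono_const (hs : s ≤ s') (h : EndRowTwinTailA v s 𝒰) : EndRowTwinTailA v s' 𝒰 :=
  fun L X hX z hz hdeg hoff => (h L X hX z hz hdeg hoff).trans hs

/-- The local (A) row is monotone in the constant. -/
theorem localEndRowA_mono_const {S₁ S₂ : PlateSystem} (hs : s ≤ s') (h : LocalEndRowA v s S₁ S₂) :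
    LocalEndRowA v s' S₁ S₂ :=
  fun X hX z hz hdeg => (h X hX z hz hdeg).trans hs

/-- The translation row is monotone in the constant. -/
theorem endRowTransA_mono_const (hs : s ≤ s') (h : EndRowTransA v s) : EndRowTransA v s' :=
  fun L => localEndRowA_mono_const hs (h L)

/-- The twin row (half-turn form) is monotone in the constant. -/
theorem endRowTwinHalfTurnA_mono_const (hs : s ≤ s') (h : EndRowTwinHalfTurnA v s) : EndRowTwinHalfTurnA v s' :=
  fun L => localEndRowA_mono_const hs (h L)

end Mono

/-- `0 < 2√6`. -/
theorem two_sqrt_six_pos : (0 : ℝ) < 2 * Real.sqrt 6 := by positivity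

/-! ### The closing theorem with tails at `2√6` -/

/-- **The crux from `P5Exhaustion`, a 𝒰_cx flat certificate at any constant `s ≤ 2√6`, and the two off-module tails
at `2√6`.** -/
theorem coaxialWallLaw_of_onSiteFlatA_twoSqrtSix_cx (ver : WordVersion) (hE1 : P5Exhaustion) {s : ℝ}
    (hs : s ≤ 2 * Real.sqrt 6) (hon : EndRowOnSiteFlatA ver s coaxialModuleUniverse)
    (htailW : EndRowTwinTailA ver (2 * Real.sqrt 6) coaxialModuleUniverse)
    (htailT : EndRowTransTailA ver (2 * Real.sqrt 6) coaxialModuleUniverse) :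
    Summit.Ventures.Crystal3D.Theses.StickyWulffConstant.CoaxialWallLaw :=
  coaxialWallLaw_of_onSiteFlatA_cx_certified ver hE1 two_sqrt_six_pos le_rfl (endRowOnSiteFlatA_mono_const hs hon)
    htailW htailT

/-- **THE LANE-F CLOSING THEOREM OF RECORD after (lxxiv): `(v2(A), r = 1)`, certificate universe 𝒰_cx at the
certificate constant `9/2`, OFF-MODULE tails at `s_F = 2√6`.** -/
theorem coaxialWallLaw_of_onSiteFlatA_v2A_twoSqrtSix_cx (hE1 : P5Exhaustion)
    (hon : EndRowOnSiteFlatA WordVersion.v2 (9 / 2) coaxialModuleUniverse)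
    (htailW : EndRowTwinTailA WordVersion.v2 (2 * Real.sqrt 6) coaxialModuleUniverse)
    (htailT : EndRowTransTailA WordVersion.v2 (2 * Real.sqrt 6) coaxialModuleUniverse) :
    Summit.Ventures.Crystal3D.Theses.StickyWulffConstant.CoaxialWallLaw :=
  coaxialWallLaw_of_onSiteFlatA_twoSqrtSix_cx WordVersion.v2 hE1 nine_halves_le_two_sqrt_six hon htailW htailT

end Summit.Ventures.Crystal3D.Theorems

end
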